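import Literature.MathematicalPhysics.QuantumLattice.StabilityLocalBoundsProofs
import Literature.MathematicalPhysics.QuantumLattice.StabilityRelativeBoundTorusProofs
import HarnessLib

/-!
# Assembly at fixed volume: from the quasi-local rotated perturbation to the analytic package

Top-down layer (seat B) of the formalisation of the Michalakis–Zwolak stability theorem
(hubbard.S19, `Literature.MathematicalPhysics.QuantumLattice.michalakis_zwolak`). This is MZ13
Proposition 1 (assembly of the transformed Hamiltonian, arXiv:1109.1588 p. 12) together with
Lemma 3, Lemma 4 and Proposition 2, at one volume `L`, one coupling and one perturbation
strength `J`: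

**Input** (the output format of MZ13 Lemmas 1–2, i.e. of the spectral flow `U(s)` and the
quasi-locality of `U⋆ 𝓕(·) U`; here a hypothesis): a unitary `U` and terms `X u i`
(`u ∈ (ℤ/Lℤ)^d`, `i ≤ L`) with `U⋆ H U = H₀ + Σ_u Σ_i X u i`, `X u i` Hermitian, supported in
`cellBall u i`, `‖X u i‖ ≤ J φ i`, and `[Σ_i X u i, P₀] = 0`.

**Output** (`exists_package_of_rotated_decomposition`): `W`, `D`, `e` with
`U⋆ H U = H₀ + W + D + e·1`, `W = 0` on `ker H₀`, `H₀ D = 0` (so `D` preserves `ker H₀`),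
`‖D‖ ≤ #(ℤ/Lℤ)^d · 2 J G` and the relative form bound
`‖⟨x, W x⟩‖ ≤ J c_L re ⟨x, H₀ x⟩`, `c_L = Σ_{j ≤ L} (2j+1)^d w_j / γloc j`, where the profile `w`
is explicit in the four numerical majorants `G ≥ Σ_i φ i g_L(i)` (Lemma 3), `Fb ≥ Σ_i φ i`,
`τ j ≥ Σ_{i > j/2} φ i` (tails) and `σ j ≥ √(2Δ(j − j/2))` (LTQO): `w_0 = 2Fb`,
`w_{j+1} = 4G + 8τ_j + 4Fb σ_j` for `2j < L` and `0` otherwise. This is exactly the shape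
`|⟨ψ, W ψ⟩| ≤ cJ ⟨ψ, H₀ ψ⟩`, `‖Δ‖ ≤ L^d max_u ‖Δ_u‖` of MZ13 §7 (p. 15) with all constants
explicit; the uniformity of `c_L` and the decay of `L^d G` in `L` are the business of the next
layer (`StabilityDecayCalculusProofs`).

No definitions, no named facts (theorems only).
-/

noncomputable section

open Matrix Finset Module
open scoped InnerProductSpace ComplexOrder Matrix.Norms.L2Operator

namespace Literature.MathematicalPhysics.QuantumLattice

open Literature.Probability.LatticeModels

section Ker

variable {Λ : Type*} [Fintype Λ] [DecidableEq Λ] {q : ℕ}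

/-- For a projector interaction, a vector in `ker H_univ` (on `EuclideanSpace`) is fixed by the
global ground-state projection: `T_{P₀} x = x`. [folklore] -/
theorem toEuclideanLin_localGroundProj_of_ker {Φ : Interaction Λ q} (hΦ : IsProjectorInteraction Φ)
    {x : EuclideanSpace ℂ (TensorIndex Λ q)}
    (hx : toEuclideanLin (localHamiltonian Φ univ) x = 0) :
    toEuclideanLin (localGroundProj Φ univ) x = x := by
  have hv : localHamiltonian Φ univ *ᵥ (WithLp.ofLp x) = 0 := by
    have := congrArg WithLp.ofLp hx
    simpa [ofLp_toLpLin] using this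
  have hmem : WithLp.ofLp x ∈ localGroundSpace Φ univ :=
    (hΦ.localHamiltonian_mulVec_eq_zero_iff univ _).1 hv
  apply WithLp.ofLp_injective 2
  rw [ofLp_toLpLin, toLin'_apply]
  exact projMatrix_map_mulVec_of_mem _ hmem

/-- If `W P₀ = 0` then `W` vanishes on `ker H_univ`. [folklore] -/
theorem toEuclideanLin_eq_zero_of_mul_localGroundProj {Φ : Interaction Λ q}
    (hΦ : IsProjectorInteraction Φ) {W : Op Λ q} (hW : W * localGroundProj Φ univ = 0)
    {x : EuclideanSpace ℂ (TensorIndex Λ q)}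
    (hx : toEuclideanLin (localHamiltonian Φ univ) x = 0) : toEuclideanLin W x = 0 := by
  rw [← toEuclideanLin_localGroundProj_of_ker hΦ hx, ← LinearMap.comp_apply,
    ← Matrix.toLpLin_mul_same, hW, map_zero, LinearMap.zero_apply]

end Ker

section Volume

variable {d L : ℕ} [NeZero L] {κ : Type*} [Fintype κ] [DecidableEq κ] {q : ℕ}

/-- **MZ13 Proposition 1 with Lemma 3, Lemma 4 and Proposition 2 at fixed volume.** See the
module docstring for the input (a `P₀`-commuting quasi-local decomposition of the rotated
perturbation) and the output (the analytic package with explicit constants).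
[cite: MichalakisZwolakCMP2013, Prop. 1, Lemmas 3–4, Prop. 2 (arXiv:1109.1588 pp. 12–15)] -/
theorem exists_package_of_rotated_decomposition {Φ : Interaction (TorusSite d L × κ) q}
    (hproj : IsProjectorInteraction Φ) (hlocal : Φ.IsLocal) {Δ : ℕ → ℝ} (hltqo : HasLTQO Φ Δ)
    (hΔ0 : ∀ ℓ, 0 ≤ Δ ℓ) {γloc : ℕ → ℝ} (hlg : HasLocalGap Φ γloc) (hγ : ∀ j, 0 < γloc j)
    (hP0 : ∀ (x : TorusSite d L) (r : ℕ),
      localGroundProj Φ (cellBall x r : Finset (TorusSite d L × κ)) ≠ 0)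
    {H U : Op (TorusSite d L × κ) q} (X : TorusSite d L → ℕ → Op (TorusSite d L × κ) q)
    (hdec : star U * H * U = localHamiltonian Φ univ + ∑ u, ∑ i ∈ range (L + 1), X u i)
    (hXs : ∀ u i, IsSupportedOn (X u i) (cellBall u i)) (hXh : ∀ u i, (X u i).IsHermitian)
    (hXc : ∀ u, Commute (∑ i ∈ range (L + 1), X u i) (localGroundProj Φ univ))
    {J : ℝ} (hJ : 0 ≤ J) {φ : ℕ → ℝ} (hφ0 : ∀ i, 0 ≤ φ i) (hXn : ∀ u i, ‖X u i‖ ≤ J * φ i)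
    {G Fb : ℝ} {τ σ : ℕ → ℝ} (hG0 : 0 ≤ G) (hFb0 : 0 ≤ Fb) (hτ0 : ∀ j, 0 ≤ τ j)
    (hσ0 : ∀ j, 0 ≤ σ j)
    (hG : ∑ i ∈ range (L + 1), φ i * (if 2 * i < L then Δ ((L - 1) / 2 - i) else 1) ≤ G)
    (hFb : ∑ i ∈ range (L + 1), φ i ≤ Fb)
    (hτ : ∀ j, ∑ i ∈ (range (L + 1)).filter (fun i => j / 2 < i), φ i ≤ τ j)
    (hσ : ∀ j, Real.sqrt (2 * Δ (j - j / 2)) ≤ σ j) :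
    ∃ (W D : Op (TorusSite d L × κ) q) (e : ℝ),
      star U * H * U = localHamiltonian Φ univ + W + D + (e : ℂ) • 1 ∧
      (∀ x : EuclideanSpace ℂ (TensorIndex (TorusSite d L × κ) q),
        toEuclideanLin (localHamiltonian Φ univ) x = 0 → toEuclideanLin W x = 0) ∧
      (∀ x : EuclideanSpace ℂ (TensorIndex (TorusSite d L × κ) q),
        toEuclideanLin (localHamiltonian Φ univ) (toEuclideanLin D x) = 0) ∧
      ‖D‖ ≤ Fintype.card (TorusSite d L) * (2 * J * G) ∧
      ∀ x : EuclideanSpace ℂ (TensorIndex (TorusSite d L × κ) q),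
        ‖⟪x, toEuclideanLin W x⟫_ℂ‖ ≤
          J * (∑ j ∈ range (L + 1), (2 * (j : ℝ) + 1) ^ d *
              (if j = 0 then 2 * Fb
                else if 2 * (j - 1) < L then 4 * G + 8 * τ (j - 1) + 4 * Fb * σ (j - 1) else 0) /
              γloc j) *
            RCLike.re ⟪x, toEuclideanLin (localHamiltonian Φ univ) x⟫_ℂ := by
  classical
  -- the site decompositions
  choose W' D' e' hid hWh hann hWP₀ hDh hDP hHD hDn hW0n hWvan hWn using
    fun u : TorusSite d L => exists_site_decomposition hltqo hΔ0 hP0 u L (X u) (hXs u) (hXh u)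
      (hXc u) hJ hφ0 (hXn u)
  set H₀ := localHamiltonian Φ univ with hH₀def
  -- the profile
  set wc : ℕ → ℝ := fun j => if j = 0 then 2 * Fb
      else if 2 * (j - 1) < L then 4 * G + 8 * τ (j - 1) + 4 * Fb * σ (j - 1) else 0 with hwcdef
  have hwc0 : ∀ j, 0 ≤ wc j := by
    intro j
    simp only [hwcdef]
    split_ifs
    · positivity
    · have := hτ0 (j - 1); have := hσ0 (j - 1); positivity
    · exact le_rfl
  -- uniform bounds on the pieces
  have hDb : ∀ u, ‖D' u‖ ≤ 2 * J * G := fun u =>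
    (hDn u).trans (mul_le_mul_of_nonneg_left hG (by positivity))
  have hWb : ∀ u j, ‖W' u j‖ ≤ J * wc j := by
    intro u j
    rcases j with _ | j
    · simp only [hwcdef, if_true]
      calc ‖W' u 0‖ ≤ 2 * J * ∑ i ∈ range (L + 1), φ i := hW0n u
        _ ≤ 2 * J * Fb := mul_le_mul_of_nonneg_left hFb (by positivity)
        _ = J * (2 * Fb) := by ring
    · simp only [hwcdef, Nat.succ_ne_zero, if_false, Nat.add_sub_cancel]
      by_cases h2 : 2 * j < L
      · rw [if_pos h2]
        have h1 := hWn u j h2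
        have hsq0 : 0 ≤ Real.sqrt (2 * Δ (j - j / 2)) := Real.sqrt_nonneg _
        have hF0 : 0 ≤ ∑ i ∈ range (L + 1), φ i := sum_nonneg fun i _ => hφ0 i
        calc ‖W' u (j + 1)‖
            ≤ 2 * ‖D' u‖ + 8 * J * (∑ i ∈ (range (L + 1)).filter (fun i => j / 2 < i), φ i) +
                4 * J * (∑ i ∈ range (L + 1), φ i) * Real.sqrt (2 * Δ (j - j / 2)) := h1
          _ ≤ 2 * (2 * J * G) + 8 * J * τ j + 4 * J * Fb * σ j := by
              gcongr
              · exact hDb u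
              · exact hτ j
              · exact hσ j
          _ = J * (4 * G + 8 * τ j + 4 * Fb * σ j) := by ring
      · rw [if_neg h2, hWvan u j (not_lt.mp h2), norm_zero, mul_zero]
  -- `Φ ∅ = 0`
  have hΦ0 : Φ ∅ = 0 :=
    apply_empty_eq_zero_of_localGroundProj_ne_zero hlocal (hP0 (fun _ => 0) 0)
  refine ⟨∑ u, ∑ j ∈ range (L + 1), W' u j, ∑ u, D' u, ∑ u, e' u, ?_, ?_, ?_, ?_, ?_⟩
  -- identity
  · rw [hdec, sum_congr rfl fun u _ => hid u]
    simp only [sum_add_distrib, Complex.ofReal_sum, sum_smul]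
    abel
  -- `W` vanishes on `ker H₀`
  · intro x hx
    rw [map_sum, LinearMap.sum_apply]
    refine sum_eq_zero fun u _ => ?_
    rw [map_sum, LinearMap.sum_apply]
    exact sum_eq_zero fun j _ => toEuclideanLin_eq_zero_of_mul_localGroundProj hproj (hWP₀ u j) hx
  -- `H₀ D = 0`
  · intro x
    rw [← LinearMap.comp_apply, ← Matrix.toLpLin_mul_same, Finset.mul_sum,
      sum_congr rfl fun u _ => hHD u, sum_const_zero, map_zero, LinearMap.zero_apply]
  -- `‖D‖`
  · calc ‖∑ u, D' u‖ ≤ ∑ u, ‖D' u‖ := norm_sum_le _ _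
      _ ≤ ∑ _u : TorusSite d L, 2 * J * G := sum_le_sum fun u _ => hDb u
      _ = Fintype.card (TorusSite d L) * (2 * J * G) := by
          rw [sum_const, card_univ, nsmul_eq_mul]
  -- the relative form bound
  · intro x
    have h := norm_inner_sum_pieces_le hproj hΦ0 hlg hγ W' L (fun u j => (hann u j).1)
      (fun u j => (hann u j).2) (w := fun j => J * wc j) (fun j => mul_nonneg hJ (hwc0 j)) hWb x
    refine h.trans (le_of_eq ?_)
    rw [mul_sum]
    congr 1
    refine sum_congr rfl fun j _ => ?_
    ring

end Volume

end Literature.MathematicalPhysics.QuantumLattice
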